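import Summits.BirchSwinnertonDyer.BirchSwinnertonDyer.Theorems.GenusKolyvaginAtTwoMinimalTwinBSDTwoTwinKolyvaginRank
import Summits.BirchSwinnertonDyer.BirchSwinnertonDyer.Theorems.GenusKolyvaginAtTwoPowDvdShaCardAtTwoRT
import Summits.BirchSwinnertonDyer.BirchSwinnertonDyer.Theorems.GenusKolyvaginAtTwoEquivariantChebotarevAtTwoR
import Summits.BirchSwinnertonDyer.BirchSwinnertonDyer.Theorems.GenusKolyvaginAtTwoCyclicTorsionOfNegDisc
import Summits.BirchSwinnertonDyer.BirchSwinnertonDyer.Theorems.GenusKolyvaginAtTwoMinimalTwinBSDTwoAnalyticTwin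
import Summits.BirchSwinnertonDyer.BirchSwinnertonDyer.Theorems.GenusKolyvaginAtTwoMinimalTwinBSDTwoSwappedPairRationalHeegnerPoint
import HarnessLib

/-!
# Route `GenusKolyvaginAtTwo`, crux U₂ `MinimalTwinBSDTwo` (stmt-BirchSwinnertonDyer-22985), LINE 23 «twin_swap» v2.5 — KEX′ AND U₂ ON THE ODD
# `Δ < 0` HABITAT CUT FROM ONE DEEP KOLYVAGIN WITNESS: the route's CLOSED lower half L_T (`powDvdShaCardAtTwoRT_proof`, whose text carries NO
# root-number binder) applies to the `ε = −1` member, and this seat's upper half (B2Q⁻, p808930–p810300) closes the index relation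

Seat `bsd-line-gk2-p2` g31 (PROVER seat 2/3, cell `bsd-f1-sign2`, LINE 23 holder), `--supports stmt-BirchSwinnertonDyer-22985 --as helper`.
THEOREMS ONLY (no definition, no named fact, no `sorry`).  BSD is NOT proved by any of this; U₂ is NOT proved; nothing is closed.  Every theorem is
CONDITIONAL on its displayed hypotheses (Q2 `KolyvaginRelationAtTwo` = item 24880; the PRINT facts GZ / GZK / modularity / Milne of LINE 23; the
twin's `BSD₂`; and a DEEP KOLYVAGIN WITNESS for the rank-one member).

THE OBSERVATION.  The route's lower half L_T `PowDvdShaCardAtTwoRT` (stmt-BirchSwinnertonDyer-23659, CLOSED: `powDvdShaCardAtTwoRT_proof`;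
antecedents Q2, Q5R = `equivariantChebotarevAtTwoR_proof` (CLOSED), Q1 = `cyclicTorsionOfNegDisc_proof` (CLOSED)) reads, on the `Δ < 0` habitat
(non-CM, odd Tamagawa product, an odd multiplicative prime, `ρ_{W,2^∞}` onto; `K` odd `d_K ≠ −3` Heegner with the two Theorem-B exclusions; `P(1)` of
infinite order with exact depth `M₀`): **a square-free `n` of DEEP Kolyvagin primes (Zhang-admissible at `2`, index `≥ 2`, `Frob_ℓ = Frob_∞`) with
`P(n) ∉ 2W(K[n])` forces `4^{M₀} ∣ #Ш(W_K)[2^∞]`** — and its text has NO root-number binder, so it holds VERBATIM for the rank-ONE member `W` of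
LINE 23 (`w(W) = −1`).  With this seat's upper half `#Ш(W_K)[2^∞] ∣ 4^{M₀}` (`…TwinKolyvaginRank`, modulo Q2 only) the `2`-primary Gross–Zagier index
relation KEX′ of LINE 23 holds on the odd `Δ < 0` cut at every frame carrying a deep witness; and g27's per-frame swapped exact descent
(`AnalyticTwin.swappedPairDescentAtTwo_shaDepth_anyTwin_of_facts`) turns it into `BSD₂(Wd) → BSD₂(W)`.

* §1 `natCard_sha_baseChange_mul_eq_pow_onOddNegCut_of_deepWitness` — **KEX′'s conclusion `#Ш(W_K)[2^∞] · 2^{2(ord₂ c + ord₂ C(W))} = 2^{2M₀}`** on the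
  odd `Δ < 0` habitat cut (`#Sel₂(W) = 2`, `w(W) = −1`, `Dt.c` odd, budget `ord₂ C(Wd) ≤ 1`) from ONE deep witness `(n, d)`, modulo Q2 ONLY.
* §2 `bsdp_onOddNegCut_of_deepWitness_of_facts` — **`BSD₂(Wd) → BSD₂(W)`** on that frame, modulo Q2 + GZ + GZK + modularity + Milne.
* §3 `minimalTwinBSDTwo_onOddNegCut_of_wall_of_witnessSupply_of_facts` — the census form: **U₂ restricted to the odd `Δ < 0` habitat cut ⟸ WALL row 1
  (`BSD₂` for non-CM analytic-rank-`0` curves) + PRINT + Q2 + a DEEP-WITNESS SUPPLY for the rank-one member** (displayed `∀∃` hypothesis: for each such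
  `W` one frame `K`, an odd-`c` datum with `P(1)` of infinite order and its exact depth, a globally minimal twin model inside the budget, and a deep
  witness).  This is the `ε = −1` mirror of the route's supply cruxes (K₄⁻ `K4Neg`, 31526, asks the same witness for the
  rank-ZERO habitat member): on the cut, U₂'s research content is «2-primitivity of the rank-one member's Kolyvagin system at deep `Frob_∞`-primes at
  ONE odd frame» — Kolyvagin's conjecture at `2` in the `M_∞ = 0` form — and no longer an unstructured `2`-adic Gross–Zagier unit statement.

HONEST FRAMING.  Nothing beyond print is proved; the witness supply is OPEN (as K₄⁻ is); at door-open frames (`#Sel₂(Wd) = 1`) the witness with `n = 1`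
is NDIV′'s bit `y_K ∉ 2W(K)` and nothing is gained there.  What is gained: at frames with `Ш(Wd)[2] ≠ 0` (`M₀ ≥ 1` expected) a witness at HIGHER
conductor suffices, exactly as on the habitat side of the route.  BSD is NOT proved.

References: [Kolyvagin1989Izv] Thm. A, Thm. B_l; [Kolyvagin1991MathAnn] (structure theorem); [McCallumLMS1991] §5 Thm. 5.4, 5.8; [GrossLMS1991] §5;
[GrossZagier1986] V.§2 (2.2); [Milne1972ArithmeticAV] §1 Thm. 1; [WZhang2014] Thm. 1.1 (the shape of the witness at p ≥ 5).
-/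

set_option autoImplicit false
set_option linter.dupNamespace false -- `Summit.<P>.<Sub>` repeats `BirchSwinnertonDyer` (D-0017)

noncomputable section

open scoped Classical

namespace Summit.BirchSwinnertonDyer.BirchSwinnertonDyer.Theorems.GenusExact.TwinSwap.TwinAnnihilation

open Literature.NumberTheory.EllipticCurves Literature.NumberTheory.GaloisRepresentations WeierstrassCurve NumberField
  IsDedekindDomain Field AddSubgroup Literature.NumberTheory.EllipticCurves.ModularForms
open Summit.BirchSwinnertonDyer.Rank1Residual
open Summit.BirchSwinnertonDyer.BirchSwinnertonDyer.Theses.GenusKolyvaginAtTwo (KolyvaginRelationAtTwo)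
open Summit.BirchSwinnertonDyer.BirchSwinnertonDyer.Theorems.GenusExact.PlusDescent

/-! ## §1 KEX′ on the odd `Δ < 0` cut from one deep witness -/

/-- **KEX′'s conclusion on the odd `Δ < 0` habitat cut from ONE deep Kolyvagin witness, modulo Q2 only**: `W/ℚ` globally minimal, non-CM, `C(W)` odd, an
odd prime `v` of multiplicative reduction, `Δ_W < 0`, `ρ_{W,2^n}` onto; `K` imaginary quadratic, `d_K` odd `≠ −3`, Heegner; a datum `Dt` with `Dt.c` odd,
`P(1)` of infinite order with exact depth `M₀`; `w(W) = −1`, `#Sel₂(W) = 2`; an elliptic model `Wd ≅ W^{(d_K)}` with `ord₂ C(Wd) ≤ 1`; a square-free `n` of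
deep Kolyvagin primes with `P(n) ∉ 2W(K[n])`.  Then **`#Ш(W_K)[2^∞] · 2^{2(ord₂ c + ord₂ C(W))} = 2^{2M₀}`**: the upper divisibility is this seat's
`finite_and_natCard_primaryComponent_sha_baseChange_two_dvd_pow_of_derivedPoint_signFree`, the lower one is the route's CLOSED L_T
`powDvdShaCardAtTwoRT_proof` (fed Q2, `equivariantChebotarevAtTwoR_proof`, `cyclicTorsionOfNegDisc_proof`), whose text has no root-number binder.
[cite: Kolyvagin1989Izv, Thm. B_l] [cite: Kolyvagin1991MathAnn, Thm. 1 (structure)] [cite: McCallumLMS1991, §5 Thm. 5.4, Thm. 5.8] -/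
theorem natCard_sha_baseChange_mul_eq_pow_onOddNegCut_of_deepWitness (hQ2 : KolyvaginRelationAtTwo)
    (W : WeierstrassCurve ℚ) [W.IsElliptic] [W.IsGloballyMinimal] [NeZero (W.conductorNorm ℤ)] (hcm : ¬ W.HasCM)
    (hT : Odd W.tamagawaProduct) (v : HeightOneSpectrum (𝓞 ℚ)) (h2v : ((2 : ℕ) : 𝓞 ℚ) ∉ v.asIdeal)
    (hNv : ((W.conductorNorm ℤ : ℕ) : 𝓞 ℚ) ∈ v.asIdeal) (hmult : W.HasMultiplicativeReductionAt v) (hneg : W.Δ < 0)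
    (K : Type) [Field K] [NumberField K] (hK : IsImaginaryQuadratic K) (hodd : Odd (NumberField.discr K))
    (h3 : NumberField.discr K ≠ -3) (hH : SatisfiesHeegnerHypothesis (W.conductorNorm ℤ) K)
    (hρ : ∀ n : ℕ, 0 < n → W.HasSurjectiveModNGaloisRep ((2 : ℤ) ^ n))
    (Dt : ModularParametrizationData W (W.conductorNorm ℤ)) (hc : Odd Dt.c) (β : ℤ) (ι : K →+* ℂ) (d₁ : KolyvaginHeegnerData Dt β ι 1)
    (hy : ¬ IsOfFinAddOrder d₁.derivedPoint) (M₀ : ℕ)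
    (hdiv : ∃ Q : (W.baseChange (ringClassField K ι 1)).toAffine.Point, ((2 ^ M₀ : ℕ) : ℤ) • Q = d₁.derivedPoint)
    (hndiv : ¬ ∃ Q : (W.baseChange (ringClassField K ι 1)).toAffine.Point, ((2 ^ (M₀ + 1) : ℕ) : ℤ) • Q = d₁.derivedPoint)
    (hw : W.rootNumber = -1) (hSel : Nat.card (W.selmerGroup 2) = 2)
    {Wd : WeierstrassCurve ℚ} [Wd.IsElliptic] (Cd : VariableChange ℚ) (hWd : Cd • W.quadraticTwist (NumberField.discr K : ℚ) = Wd)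
    (hbudget : padicValNat 2 Wd.tamagawaProduct ≤ 1)
    (n : ℕ) (d : KolyvaginHeegnerData Dt β ι n) (hn : Squarefree n)
    (hdeep : ∀ ℓ ∈ n.primeFactors, Zhang2014.IsKolyvaginPrime (W.conductorNorm ℤ) W K 2 ℓ ∧ 2 ≤ Zhang2014.kolyvaginIndex W 2 ℓ ∧
      FrobEqFrobInfty W K 2 ℓ)
    (hPn : ¬ ∃ Q : (W.baseChange (ringClassField K ι n)).toAffine.Point, (2 : ℤ) • Q = d.derivedPoint) :
    Nat.card (AddCommGroup.primaryComponent (W.baseChange K).sha 2) *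
        2 ^ (2 * (padicValInt 2 Dt.c + padicValNat 2 W.tamagawaProduct)) = 2 ^ (2 * M₀) := by
  haveI : Fact (Nat.Prime 2) := ⟨Nat.prime_two⟩
  have hc2 : padicValInt 2 Dt.c = 0 :=
    padicValInt.eq_zero_of_not_dvd fun h ↦ (Int.not_even_iff_odd.mpr hc) (even_iff_two_dvd.mpr (by exact_mod_cast h))
  have hC2 : padicValNat 2 W.tamagawaProduct = 0 :=
    padicValNat.eq_zero_of_not_dvd fun h ↦ (Nat.not_even_iff_odd.mpr hT) (even_iff_two_dvd.mpr h)
  rw [hc2, hC2, add_zero, mul_zero, pow_zero, mul_one]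
  obtain ⟨hsq1, hsq2⟩ := kolyvaginExclusions_of_odd_of_satisfiesHeegnerHypothesis W hK hodd hH
  refine Nat.dvd_antisymm ?_ ?_
  · -- the upper half: this seat's swapped engine (B2Q⁻±) + RANKQ⁻ + sandwich, modulo Q2 only
    exact (finite_and_natCard_primaryComponent_sha_baseChange_two_dvd_pow_of_derivedPoint_signFree hQ2 W hcm hT v h2v hNv hmult K hK hodd h3 hH
      hρ Dt β ι d₁ hy M₀ hndiv hw hSel Cd hWd (Or.inl ⟨hneg, hbudget⟩)).2
  · -- the lower half: the route's CLOSED L_T, read for the `ε = −1` member (no root-number binder in its text)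
    exact powDvdShaCardAtTwoRT_proof hQ2 GenusExact.equivariantChebotarevAtTwoR_proof GenusCyclicTorsion.cyclicTorsionOfNegDisc_proof W hcm hT
      v h2v hNv hmult hneg K hK hodd h3 hH hsq1 hsq2 hρ Dt β ι d₁ hy M₀ hdiv hndiv n d hn hdeep hPn

/-! ## §2 `BSD₂(Wd) → BSD₂(W)` on that frame -/

/-- **`BSD₂(Wd) → BSD₂(W)` on the odd `Δ < 0` habitat cut from ONE deep witness**, modulo Q2 and LINE 23's four PRINT facts (GZ all levels, GZK,
modularity, Milne any-model): §1 gives the exactness-shaped input of g27's per-frame swapped exact descent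
`AnalyticTwin.swappedPairDescentAtTwo_shaDepth_anyTwin_of_facts`; `w(W) = −1` comes from `r_an(W) = 1` (`TwinSwapBit.rootNumber_eq_neg_one_of_analyticRank_eq_one`).
CONDITIONAL; closes nothing; BSD is NOT proved. [cite: GrossZagier1986, V.§2 (2.2)] [cite: Milne1972ArithmeticAV, §1 Thm. 1] [cite: Kolyvagin1989Izv, Thm. B_l]
[cite: McCallumLMS1991, §5 Thm. 5.4, Thm. 5.8] -/
theorem bsdp_onOddNegCut_of_deepWitness_of_facts (hQ2 : KolyvaginRelationAtTwo)
    (hGZ : ∀ (N : ℕ) [NeZero N] (W : WeierstrassCurve ℚ) (K : Type) [Field K] [NumberField K], gross_zagier N W K)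
    (hGZK : rank_eq_analyticRank_of_analyticRank_le_one) (hmod : hasEntireLFunction_rat)
    (hMilneC : Milne1972.bsdQuotient_baseChange_quadratic_anyModel)
    (W : WeierstrassCurve ℚ) [W.IsElliptic] [W.IsGloballyMinimal] [NeZero (W.conductorNorm ℤ)] (hcm : ¬ W.HasCM)
    (hr : W.analyticRank = 1) (hSel : Nat.card (W.selmerGroup 2) = 2)
    (hT : Odd W.tamagawaProduct) (v : HeightOneSpectrum (𝓞 ℚ)) (h2v : ((2 : ℕ) : 𝓞 ℚ) ∉ v.asIdeal)
    (hNv : ((W.conductorNorm ℤ : ℕ) : 𝓞 ℚ) ∈ v.asIdeal) (hmult : W.HasMultiplicativeReductionAt v) (hneg : W.Δ < 0)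
    (hρ : ∀ n : ℕ, 0 < n → W.HasSurjectiveModNGaloisRep ((2 : ℤ) ^ n))
    (K : Type) [Field K] [NumberField K] (hK : IsImaginaryQuadratic K) (hodd : Odd (NumberField.discr K))
    (h3 : NumberField.discr K ≠ -3) (hH : SatisfiesHeegnerHypothesis (W.conductorNorm ℤ) K)
    (Dt : ModularParametrizationData W (W.conductorNorm ℤ)) (hc : Odd Dt.c) (β : ℤ) (ι : K →+* ℂ) (d₁ : KolyvaginHeegnerData Dt β ι 1)
    (hy : ¬ IsOfFinAddOrder d₁.derivedPoint) (M₀ : ℕ)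
    (hdiv : ∃ Q : (W.baseChange (ringClassField K ι 1)).toAffine.Point, ((2 ^ M₀ : ℕ) : ℤ) • Q = d₁.derivedPoint)
    (hndiv : ¬ ∃ Q : (W.baseChange (ringClassField K ι 1)).toAffine.Point, ((2 ^ (M₀ + 1) : ℕ) : ℤ) • Q = d₁.derivedPoint)
    (Wd : WeierstrassCurve ℚ) [Wd.IsElliptic] [Wd.IsGloballyMinimal]
    (hWd : ∃ C : VariableChange ℚ, C • W.quadraticTwist (NumberField.discr K : ℚ) = Wd)
    (hbudget : padicValNat 2 Wd.tamagawaProduct ≤ 1) (hBSDd : BSDp Wd 2)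
    (n : ℕ) (d : KolyvaginHeegnerData Dt β ι n) (hn : Squarefree n)
    (hdeep : ∀ ℓ ∈ n.primeFactors, Zhang2014.IsKolyvaginPrime (W.conductorNorm ℤ) W K 2 ℓ ∧ 2 ≤ Zhang2014.kolyvaginIndex W 2 ℓ ∧
      FrobEqFrobInfty W K 2 ℓ)
    (hPn : ¬ ∃ Q : (W.baseChange (ringClassField K ι n)).toAffine.Point, (2 : ℤ) • Q = d.derivedPoint) :
    BSDp W 2 := by
  have hw : W.rootNumber = -1 := TwinSwapBit.rootNumber_eq_neg_one_of_analyticRank_eq_one W hr Dt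
  have hc0 : Dt.c ≠ 0 := by
    obtain ⟨k, hk⟩ := hc
    omega
  obtain ⟨Cd, hCd⟩ := hWd
  have hsha := natCard_sha_baseChange_mul_eq_pow_onOddNegCut_of_deepWitness hQ2 W hcm hT v h2v hNv hmult hneg K hK hodd h3 hH hρ Dt hc β ι d₁ hy
    M₀ hdiv hndiv hw hSel Cd hCd hbudget n d hn hdeep hPn
  exact AnalyticTwin.swappedPairDescentAtTwo_shaDepth_anyTwin_of_facts hGZ hGZK hmod hMilneC W hr hSel K hK hodd h3 hH Dt hc0 β ι d₁ hy M₀ hdiv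
    hndiv hsha Wd ⟨Cd, hCd⟩ hBSDd

/-! ## §3 The census form: U₂ on the cut from WALL row 1 + PRINT + Q2 + a deep-witness supply -/

/-- **U₂ ON THE ODD `Δ < 0` HABITAT CUT ⟸ WALL row 1 + PRINT + Q2 + DEEP-WITNESS SUPPLY⁻.**  Displayed hypotheses: S1′ = `BSD₂` for every non-CM
globally minimal curve of analytic rank `0` (WALL row 1 of route ByReductionTypeAtTwo); the four PRINT facts; Q2; and the SUPPLY: for every `W` on the
cut (non-CM, `r_an = 1`, `#Sel₂ = 2`, `C(W)` odd, an odd multiplicative prime, `Δ < 0`, `ρ_{W,2^∞}` onto) ONE odd Heegner frame `K ≠ ℚ(√−3)` with an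
odd-`c` datum, `P(1)` of infinite order and its exact depth `M₀`, a globally minimal twin model `Wd` inside the budget `ord₂ C(Wd) ≤ 1`, and a square-free
`n` of deep Kolyvagin primes with `P(n) ∉ 2W(K[n])`.  Then `BSD₂(W)` for every `W` on the cut (the twin is non-CM — same `j` — of analytic rank `0` by
Gross–Zagier, `analyticRank_twist_eq_zero_of_rankOne`, so S1′ pays `BSD₂(Wd)`).  CONDITIONAL on
every displayed hypothesis; the supply is OPEN (the `ε = −1` twin of K₄⁻ `K4Neg`); closes nothing; BSD is NOT proved.
[cite: Kolyvagin1989Izv, Thm. A, Thm. B_l] [cite: Kolyvagin1991MathAnn, Thm. 1] [cite: GrossZagier1986, V.§2 (2.2)] [cite: WZhang2014, Thm. 1.1] -/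
theorem minimalTwinBSDTwo_onOddNegCut_of_wall_of_witnessSupply_of_facts (hQ2 : KolyvaginRelationAtTwo)
    (hGZ : ∀ (N : ℕ) [NeZero N] (W : WeierstrassCurve ℚ) (K : Type) [Field K] [NumberField K], gross_zagier N W K)
    (hGZK : rank_eq_analyticRank_of_analyticRank_le_one) (hmod : hasEntireLFunction_rat)
    (hMilneC : Milne1972.bsdQuotient_baseChange_quadratic_anyModel)
    (hS1 : ∀ (W : WeierstrassCurve ℚ) [W.IsElliptic] [W.IsGloballyMinimal], ¬ W.HasCM → W.analyticRank = 0 → BSDp W 2)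
    (hSupply : ∀ (W : WeierstrassCurve ℚ) [W.IsElliptic] [W.IsGloballyMinimal] [NeZero (W.conductorNorm ℤ)],
      ¬ W.HasCM → W.analyticRank = 1 → Nat.card (W.selmerGroup 2) = 2 → Odd W.tamagawaProduct → W.Δ < 0 →
      (∀ n : ℕ, 0 < n → W.HasSurjectiveModNGaloisRep ((2 : ℤ) ^ n)) →
      (∃ v : HeightOneSpectrum (𝓞 ℚ), ((2 : ℕ) : 𝓞 ℚ) ∉ v.asIdeal ∧ ((W.conductorNorm ℤ : ℕ) : 𝓞 ℚ) ∈ v.asIdeal ∧ W.HasMultiplicativeReductionAt v) →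
      ∃ (K : Type) (_ : Field K) (_ : NumberField K), IsImaginaryQuadratic K ∧ Odd (NumberField.discr K) ∧ NumberField.discr K ≠ -3 ∧
        SatisfiesHeegnerHypothesis (W.conductorNorm ℤ) K ∧
        ∃ (Dt : ModularParametrizationData W (W.conductorNorm ℤ)) (β : ℤ) (ι : K →+* ℂ) (d₁ : KolyvaginHeegnerData Dt β ι 1) (M₀ : ℕ),
          Odd Dt.c ∧ ¬ IsOfFinAddOrder d₁.derivedPoint ∧
          (∃ Q : (W.baseChange (ringClassField K ι 1)).toAffine.Point, ((2 ^ M₀ : ℕ) : ℤ) • Q = d₁.derivedPoint) ∧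
          (¬ ∃ Q : (W.baseChange (ringClassField K ι 1)).toAffine.Point, ((2 ^ (M₀ + 1) : ℕ) : ℤ) • Q = d₁.derivedPoint) ∧
          (∃ (Wd : WeierstrassCurve ℚ) (_ : Wd.IsElliptic) (_ : Wd.IsGloballyMinimal),
            (∃ C : VariableChange ℚ, C • W.quadraticTwist (NumberField.discr K : ℚ) = Wd) ∧ padicValNat 2 Wd.tamagawaProduct ≤ 1) ∧
          ∃ (n : ℕ) (d : KolyvaginHeegnerData Dt β ι n), Squarefree n ∧
            (∀ ℓ ∈ n.primeFactors, Zhang2014.IsKolyvaginPrime (W.conductorNorm ℤ) W K 2 ℓ ∧ 2 ≤ Zhang2014.kolyvaginIndex W 2 ℓ ∧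
              FrobEqFrobInfty W K 2 ℓ) ∧
            ¬ ∃ Q : (W.baseChange (ringClassField K ι n)).toAffine.Point, (2 : ℤ) • Q = d.derivedPoint) :
    ∀ (W : WeierstrassCurve ℚ) [W.IsElliptic] [W.IsGloballyMinimal] [NeZero (W.conductorNorm ℤ)],
      ¬ W.HasCM → W.analyticRank = 1 → Nat.card (W.selmerGroup 2) = 2 → Odd W.tamagawaProduct → W.Δ < 0 →
      (∀ n : ℕ, 0 < n → W.HasSurjectiveModNGaloisRep ((2 : ℤ) ^ n)) →
      (∃ v : HeightOneSpectrum (𝓞 ℚ), ((2 : ℕ) : 𝓞 ℚ) ∉ v.asIdeal ∧ ((W.conductorNorm ℤ : ℕ) : 𝓞 ℚ) ∈ v.asIdeal ∧ W.HasMultiplicativeReductionAt v) →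
      BSDp W 2 := by
  intro W _ _ _ hcm hr hSel hT hneg hρ hv
  obtain ⟨K, _, _, hK, hodd, h3, hH, Dt, β, ι, d₁, M₀, hc, hy, hdiv, hndiv, ⟨Wd, _, _, ⟨Cd, hCd⟩, hbudget⟩, n, d, hn, hdeep, hPn⟩ :=
    hSupply W hcm hr hSel hT hneg hρ hv
  obtain ⟨v, h2v, hNv, hmult⟩ := hv
  -- the twin model is non-CM (same `j`) of analytic rank `0` (Gross–Zagier: `L′(W/K,1) = L′(W,1)·L(W^{(d_K)},1) ≠ 0`), so `BSD₂(Wd)` by S1′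
  have hD0 : (NumberField.discr K : ℚ) ≠ 0 := by exact_mod_cast NumberField.discr_ne_zero K
  haveI hTell : (W.quadraticTwist (NumberField.discr K : ℚ)).IsElliptic := W.isElliptic_quadraticTwist hD0
  obtain ⟨Ph, hPh, hPhmap⟩ := AdditiveKoly.exists_isHeegnerPoint_map_eq_derivedPoint_one (W := W) (K := K) (Dt := Dt) (β := β)
    (ι := ι) hK hH d₁
  have hPinf : ¬ IsOfFinAddOrder Ph := by
    intro hfin
    apply hy
    rw [← hPhmap]
    exact (WeierstrassCurve.Affine.Point.map (W' := W) (algebraMap K (ringClassField K ι 1)).toRatAlgHom).isOfFinAddOrder hfin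
  have hrT : (W.quadraticTwist (NumberField.discr K : ℚ)).analyticRank = 0 :=
    analyticRank_twist_eq_zero_of_rankOne W K (hGZ _ W K) hmod hK hH hr hPh hPinf
  subst hCd
  have hcmd : ¬ (Cd • W.quadraticTwist (NumberField.discr K : ℚ)).HasCM := by
    rw [hasCM_iff_of_j_eq (((W.quadraticTwist (NumberField.discr K : ℚ)).variableChange_j Cd).trans (W.j_quadraticTwist hD0))]
    exact hcm
  have hrd : (Cd • W.quadraticTwist (NumberField.discr K : ℚ)).analyticRank = 0 := by
    rw [analyticRank_smul]
    exact hrT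
  exact bsdp_onOddNegCut_of_deepWitness_of_facts hQ2 hGZ hGZK hmod hMilneC W hcm hr hSel hT v h2v hNv hmult hneg hρ K hK hodd h3 hH Dt hc β ι d₁ hy
    M₀ hdiv hndiv (Cd • W.quadraticTwist (NumberField.discr K : ℚ)) ⟨Cd, rfl⟩ hbudget (hS1 _ hcmd hrd) n d hn hdeep hPn

end Summit.BirchSwinnertonDyer.BirchSwinnertonDyer.Theorems.GenusExact.TwinSwap.TwinAnnihilation

end
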